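import Literature.AnabelianGeometry.EtaleTheta.Discharge.Sec4Prop43ii
import Literature.AnabelianGeometry.EtaleTheta.Discharge.Sec4Prop43i

/-!
# [EtTh] Prop 4.3 (ii) and Thm 4.4 (iv) AS TYPED: the structural hypotheses discharged — unconditional at the tree vocabulary

Mochizuki, *The étale theta function and its Frobenioid-theoretic manifestations*, Publ. RIMS **45**
(2009), §4, Prop. 4.3 (ii) p.91, Thm. 4.4 (iv) p.94 [cite: MochizukiEtTh2009, Prop 4.3 (ii) p.91;
Thm 4.4 (iv) p.94].

abc-iut cell, layer L2, nodes `EtTh:Prop4.3(ii)` / `EtTh:Thm4.4(iv)`; PROOF-ONLY companion (no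
definitions, no named facts) of abc-iut-w5-d063's `Discharge/Sec4Prop43ii.lean` (`prop43_ii_of`,
`thm44_iv_of`: [EtTh] Prop. 4.3 (ii) / Thm. 4.4 (iv) as typed by abc-iut-L2-t3 in `BiKummerRoots.lean`,
modulo only `Φ` divisorial and `B` group-like — [FrdI] Thm. 5.2 (ii)), written as the RQ7 kernel probe of
that file (seat abc-iut-L6-t23): the two residual structural hypotheses are discharged exactly as
abc-iut-L6-t12's `prop43_i_of'` / `prop43_i_of_tree` (`Discharge/Sec4Prop43i.lean`) do for Prop. 4.3 (i):
* `B` group-like ALWAYS — abc-iut-L2-t3's `TemperedFrobenioid.ratFnFunctor_isGroupLike_holds` (from the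
  Def. 3.6 (i) field `isUnit_BΛ`): `prop43_ii_of'`, `thm44_iv_of'`;
* `Φ` divisorial at the tree's canonical [FrdI] category vocabulary `treeCatVocab` ("divisorial monoid on
  `D`" = `IsMonoidOn Φ ∧ Objectwise IsDivisorial Φ`, the Def. 3.6 (ii) field `isDivisorialOn`) —
  `TemperedFrobenioid.isDivisorial_divisorMonoid`: `prop43_ii_of_tree`, `thm44_iv_of_tree`.
So, at the tree vocabulary, [EtTh] Prop. 4.3 (ii) and Thm. 4.4 (iv) AS TYPED hold outright.  (Typed (ii) is
the same-`N`-th-root special case of print's (ii) and typed (iv) carries the `Ψ`-identifications as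
hypotheses — both documented as WEAKER than print in `BiKummerRoots.lean`; nothing here changes that.)
HONEST FRAMING: [EtTh] is refereed; nothing here asserts that such data exist for an actual curve; no side
is taken on any disputed claim downstream ([IUTchIII] Cor. 3.12); typed ≠ proved for anything not proved here.
-/

noncomputable section

namespace Literature.AnabelianGeometry.EtaleTheta

open CategoryTheory Opposite Literature.AlgebraicGeometry.Frobenioids

universe u₀ v₀ u v w

variable {K : Type u₀} [Field K]

namespace BiKummerSetting

/-! ### `B` group-like discharged -/

section General

variable {X : SemiGraphs.TemperedArithmeticGroup.{u₀} K} {D₀ : Type u₀} [Category.{v₀} D₀]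
  {V : FrdIMonoidStub.{w}} {T : RealifiedDivisorMonoids (D₀ := D₀) V} {D : Type u} [Category.{v} D]
  {VD : FrdICatStub.{u, v, w} D} {S : BiKummerSetting X T D VD}

/-- **[EtTh] Prop. 4.3 (ii)** as typed (`Prop43_ii`: two bi-Kummer `N`-th roots on the same `N`-th root
with the same identification and `O^×(A_N)`-conjugate trivializing sections differ by the conjugation
operations (a), (b), p.91), modulo `Φ` divisorial ONLY — `B` group-like is unconditional
(`ratFnFunctor_isGroupLike_holds`). [cite: MochizukiEtTh2009, Prop 4.3 (ii) p.91] -/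
theorem prop43_ii_of' (hΦd : Objectwise (fun M _ => IsDivisorial M) S.tf.divisorMonoid)
    (pullFrac : ∀ {A A' : S.C} (_ : A' ⟶ A), S.biratUnits A → S.biratUnits A') :
    S.Prop43_ii pullFrac :=
  prop43_ii_of hΦd S.tf.ratFnFunctor_isGroupLike_holds pullFrac

variable {K' : Type u₀} [Field K'] {X₁ : SemiGraphs.TemperedArithmeticGroup.{u₀} K}
  {X₂ : SemiGraphs.TemperedArithmeticGroup.{u₀} K'} {D₀' : Type u₀} [Category.{v₀} D₀']
  {T₁ : RealifiedDivisorMonoids (D₀ := D₀) V} {T₂ : RealifiedDivisorMonoids (D₀ := D₀') V}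
  {D₁ D₂ : Type u} [Category.{v} D₁] [Category.{v} D₂] {VD₁ : FrdICatStub.{u, v, w} D₁}
  {VD₂ : FrdICatStub.{u, v, w} D₂} {S₁ : BiKummerSetting X₁ T₁ D₁ VD₁} {S₂ : BiKummerSetting X₂ T₂ D₂ VD₂}

/-- **[EtTh] Thm. 4.4 (iv)** as typed (`Thm44_iv`, p.94: "`Ψ` is compatible with bi-Kummer `N`-th roots"
up to the conjugation operations (a), (b)), modulo `Φ₂` divisorial ONLY.
[cite: MochizukiEtTh2009, Thm 4.4 (iv) p.94] -/
theorem thm44_iv_of' (h : Thm44Hyp S₁ S₂)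
    (ψ : ∀ A : S₁.C, S₁.biratUnits A ≃* S₂.biratUnits (h.Ψ.functor.obj A))
    (pullFrac₁ : ∀ {A A' : S₁.C} (_ : A' ⟶ A), S₁.biratUnits A → S₁.biratUnits A')
    (pullFrac₂ : ∀ {A A' : S₂.C} (_ : A' ⟶ A), S₂.biratUnits A → S₂.biratUnits A')
    (hΦd : Objectwise (fun M _ => IsDivisorial M) S₂.tf.divisorMonoid) :
    Thm44_iv h ψ pullFrac₁ pullFrac₂ :=
  thm44_iv_of h ψ pullFrac₁ pullFrac₂ hΦd S₂.tf.ratFnFunctor_isGroupLike_holds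

end General

/-! ### At the tree vocabulary: unconditional -/

section Tree

variable {X : SemiGraphs.TemperedArithmeticGroup.{u₀} K} {D₀ : Type u₀} [Category.{v₀} D₀]
  {V : FrdIMonoidStub.{w}} {T : RealifiedDivisorMonoids (D₀ := D₀) V} {D : Type u} [Category.{v} D]
  {IsRational IsStrictlyRational : (Dᵒᵖ ⥤ CommMonCat.{w}) → Prop}
  {S : BiKummerSetting X T D (treeCatVocab D IsRational IsStrictlyRational)}

/-- **[EtTh] Prop. 4.3 (ii) as typed, UNCONDITIONAL at the tree vocabulary** (`treeCatVocab`: `Φ`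
divisorial by `isDivisorial_divisorMonoid`, `B` group-like by `ratFnFunctor_isGroupLike_holds`).
[cite: MochizukiEtTh2009, Prop 4.3 (ii) p.91] -/
theorem prop43_ii_of_tree
    (pullFrac : ∀ {A A' : S.C} (_ : A' ⟶ A), S.biratUnits A → S.biratUnits A') :
    S.Prop43_ii pullFrac :=
  prop43_ii_of S.tf.isDivisorial_divisorMonoid S.tf.ratFnFunctor_isGroupLike_holds pullFrac

variable {K' : Type u₀} [Field K'] {X₁ : SemiGraphs.TemperedArithmeticGroup.{u₀} K}
  {X₂ : SemiGraphs.TemperedArithmeticGroup.{u₀} K'} {D₀' : Type u₀} [Category.{v₀} D₀']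
  {T₁ : RealifiedDivisorMonoids (D₀ := D₀) V} {T₂ : RealifiedDivisorMonoids (D₀ := D₀') V}
  {D₁ D₂ : Type u} [Category.{v} D₁] [Category.{v} D₂] {VD₁ : FrdICatStub.{u, v, w} D₁}
  {IsRational₂ IsStrictlyRational₂ : (D₂ᵒᵖ ⥤ CommMonCat.{w}) → Prop}
  {S₁ : BiKummerSetting X₁ T₁ D₁ VD₁}
  {S₂ : BiKummerSetting X₂ T₂ D₂ (treeCatVocab D₂ IsRational₂ IsStrictlyRational₂)}

/-- **[EtTh] Thm. 4.4 (iv) as typed, UNCONDITIONAL when the target setting `C₂` is at the tree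
vocabulary** (the only structural hypotheses of `thm44_iv_of` concern `C₂`).
[cite: MochizukiEtTh2009, Thm 4.4 (iv) p.94] -/
theorem thm44_iv_of_tree (h : Thm44Hyp S₁ S₂)
    (ψ : ∀ A : S₁.C, S₁.biratUnits A ≃* S₂.biratUnits (h.Ψ.functor.obj A))
    (pullFrac₁ : ∀ {A A' : S₁.C} (_ : A' ⟶ A), S₁.biratUnits A → S₁.biratUnits A')
    (pullFrac₂ : ∀ {A A' : S₂.C} (_ : A' ⟶ A), S₂.biratUnits A → S₂.biratUnits A') :
    Thm44_iv h ψ pullFrac₁ pullFrac₂ :=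
  thm44_iv_of h ψ pullFrac₁ pullFrac₂ S₂.tf.isDivisorial_divisorMonoid S₂.tf.ratFnFunctor_isGroupLike_holds

end Tree

end BiKummerSetting

end Literature.AnabelianGeometry.EtaleTheta

end
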